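import Literature.NumberTheory.Automorphic.UnitaryGroupModularLocus
import Literature.NumberTheory.Automorphic.SelfDualLatticeCountFrameTransportCM
import Literature.NumberTheory.Automorphic.UnitaryOrbitalIntegralSimilitudeTransport
import HarnessLib

/-!
# The ϖ-modular lattices of `(Φ₂)_w` at an unramified non-split CM place: ONE `U((Φ₂)_w)(L_w)`-orbit through `diag(1, ϖ_w)𝒪_w²`, stabilisers
# conjugate to `K¹ = U ∩ diag(1,ϖ_w)·GL₂(𝒪_w)·diag(1,ϖ_w)⁻¹` (Kottwitz 1988 §2 — the second vertex colour of the tree of `U(1,1)`; Jacobowitz 1962 §7)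

Topic `NumberTheory/Automorphic`; namespace `Literature.NumberTheory.Automorphic.UnitaryGroup`.  KERNEL ONLY: theorems, no definition, no instance, no
notation, no named fact, no `sorry`.  Cell `pub/hodgecm-mathlib`, F0∕P3a road «R1LL-tree» (architect A-p16 (g27) RULINGS A-2 (d) ∕ A-3 (b)): the CM-place
instance of ★ `UnitaryGroupModularLocus` (the ϖ-MODULAR MIRROR of ★ `UnitaryGroupSelfDualLocus`), typed so that the support localisation's vertex frame
(I-5a, `∃ g e, e ≤ 1 ∧ (∃ J′ ∈ GL₂(𝒪_w), ϖ_w^e • ↑J′ = ᵗσ_w(g)(Φ₂)_w g) ∧ g⁻¹γg ∈ GL₂(𝒪_w)`) yields, at `e = 1`, `γ ∈ y K¹ y⁻¹` in one line.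
HONEST LABEL: HC_CM is proved only modulo the printed citations until rung 0 closes; nothing printed is asserted here — elementary lattice algebra.

* THE CARRIER `(Φ₂)_w` at a place `v` of `L⁺` unramified and non-split in the CM field `L`: the scaling similitude is
  `S := diag(1, ϖ_w)` (★ B-p10 `formCongr_glDiagonal_one_eq_smul_placeForm_antidiag`: `ᵗσ_w(S)(Φ₂)_wS = ϖ_w • (Φ₂)_w`);
  **`exists_mem_unitaryGroupOfForm_mul_glDiagonal_mul_of_modular_antidiagTwo`** (`g = u·diag(1,ϖ_w)·k`), **`…_span_eq_and_conj_mem_…`** (one `U`-orbit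
  of ϖ-modular lattices; stabilisers = conjugates of `K¹ = U ∩ diag(1,ϖ_w)GL₂(𝒪_w)diag(1,ϖ_w)⁻¹`), **`…_conj_mem_map_conj_glDiagonal_…`** and
  **`exists_eq_mul_mul_inv_of_modular_antidiagTwo`** (the `e = 1` half of «`{γ ∈ U | tr γ ∈ 𝒪_w} = ⋃ yK⁰y⁻¹ ∪ ⋃ yK¹y⁻¹`» on the carrier
  `↥ShimuraVarieties.unitaryGroup σ_w (Φ₂)_w`, `K′`-token of ★ `IwahoriGLTwoVertexStabilizers`).

References: [Jacobowitz1962] R. Jacobowitz, *Hermitian forms over local fields*, Amer. J. Math. 84 (1962), §7; [Kottwitz1988] R. E. Kottwitz, *Tamagawa numbers*,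
Ann. of Math. 127 (1988), §2; [Kottwitz1992] R. E. Kottwitz, *Points on some Shimura varieties over finite fields*, JAMS 5 (1992), §7; [Rogawski1990] §3.5 p. 29.
-/

set_option autoImplicit false

open NumberField IsDedekindDomain
open scoped Matrix ValuativeRel

namespace Literature.NumberTheory.Automorphic.UnitaryGroup

open Literature.NumberTheory.Automorphic

/-! ## The carrier `(Φ₂)_w` at an unramified non-split CM place: `S = diag(1, ϖ_w)`, `K¹ = U((Φ₂)_w) ∩ diag(1,ϖ_w)·GL₂(𝒪_w)·diag(1,ϖ_w)⁻¹` -/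

section CM

open Literature.NumberTheory.GaloisRepresentations

variable (L : Type) [Field L] [NumberField L] [IsCMField L] (v : HeightOneSpectrum (𝓞 ↥(maximalRealSubfield L)))
  (w : PlacesOver L v) (hw : IsCMField.complexConj L • w.1 = w.1)

include hw in
/-- **`U((Φ₂)_w)(L_w)` IS TRANSITIVE ON ϖ-MODULAR LATTICES** at a place `v` of `L⁺` unramified and non-split in the CM field `L` (`w ∣ v`, `c̄ • w = w`):
every `g ∈ GL₂(L_w)` with `ᵗσ_w(g)·(Φ₂)_w·g ∈ ϖ_w · GL₂(𝒪_w)` is `u · diag(1, ϖ_w) · k` with `u ∈ U((Φ₂)_w)(L_w)`, `k ∈ GL₂(𝒪_w)` (§2 over ★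
`exists_mem_unitaryGroupOfForm_mul_of_selfDual_of_nonsplit`, `(Φ₂)_w ∈ GL₂(𝒪_w)` ★ `unit_placeForm_antidiagOne_mem_glInt`). [cite: Jacobowitz1962, §7 Thm. 7.1]
[cite: Kottwitz1988, §2] [cite: Kottwitz1992, §7 Cor. 7.3] -/
theorem exists_mem_unitaryGroupOfForm_mul_glDiagonal_mul_of_modular_antidiagTwo (hunr : Algebra.IsUnramifiedIn (𝓞 L) v.asIdeal)
    (g : GL (Fin 2) (w.1.adicCompletion L))
    (hg : ∃ J' ∈ glInt 2 (w.1.adicCompletion L),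
      (toPlace v w (HeckeCharacter.uniformizer ↥(maximalRealSubfield L) v : v.adicCompletion ↥(maximalRealSubfield L))) •
          (J' : Matrix (Fin 2) (Fin 2) (w.1.adicCompletion L)) =
        formCongr (galAdicCompletionMap (L := L) (IsCMField.complexConj L) hw) g
          (placeForm (Matrix.of fun i j : Fin 2 => if i.val + j.val + 1 = 2 then (1 : L) else 0) w.1)) :
    ∃ u ∈ unitaryGroupOfForm (galAdicCompletionMap (L := L) (IsCMField.complexConj L) hw)
        (placeForm (Matrix.of fun i j : Fin 2 => if i.val + j.val + 1 = 2 then (1 : L) else 0) w.1),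
      ∃ k ∈ glInt 2 (w.1.adicCompletion L),
        g = u * glDiagonal 2 (w.1.adicCompletion L)
          ![1, Units.mk0 (toPlace v w (HeckeCharacter.uniformizer ↥(maximalRealSubfield L) v : v.adicCompletion ↥(maximalRealSubfield L)))
            (toPlace_uniformizer_ne_zero L v w hunr)] * k := by
  have hJ := unit_placeForm_antidiagOne_mem_glInt (E := L) 2 w.1
  have hcoe : (((isUnit_placeForm_antidiagOne (E := L) 2 w.1).unit : GL (Fin 2) (w.1.adicCompletion L)) :
      Matrix (Fin 2) (Fin 2) (w.1.adicCompletion L)) =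
      placeForm (Matrix.of fun i j : Fin 2 => if i.val + j.val + 1 = 2 then (1 : L) else 0) w.1 := IsUnit.unit_spec _
  have hJh := placeForm_antidiagTwo_hermitian L v w hw
  rw [← hcoe] at hJh hg ⊢
  exact exists_mem_unitaryGroupOfForm_mul_mul_of_modular_of_nonsplit (IsCMField.complexConj L) w (IsCMField.complexConj_ne_one L) hw hunr
    _ hJ hJh (toPlace_uniformizer_ne_zero L v w hunr) _
    (by rw [hcoe]
        exact formCongr_glDiagonal_one_eq_smul_placeForm_antidiag L w hw (Units.mk0 _ (toPlace_uniformizer_ne_zero L v w hunr))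
          (galAdicCompletionMap_toPlace_self L v w hw _)) g hg

include hw in
/-- **THE ϖ-MODULAR LATTICES OF `(Φ₂)_w` ARE ONE `U`-ORBIT AND THEIR STABILISERS ARE THE CONJUGATES OF `K¹`**: if `Λ(g)` is ϖ-modular
(`ᵗσ_w(g)(Φ₂)_w g ∈ ϖ_w·GL₂(𝒪_w)`) then `Λ(g) = Λ(u·diag(1,ϖ_w))` for some `u ∈ U((Φ₂)_w)(L_w)`, and every `γ` with `γ·Λ(g) = Λ(g)` satisfies
`u⁻¹ γ u ∈ diag(1,ϖ_w)·GL₂(𝒪_w)·diag(1,ϖ_w)⁻¹` (★ `mem_map_conj_iff` token `(glInt 2 L_w).map (MulAut.conj S).toMonoidHom`, the `K′` of ★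
`IwahoriGLTwoVertexStabilizers`) — the second colour of the support localisation «`{tr g ∈ 𝒪_w} ⊆ ⋃_u uK⁰u⁻¹ ∪ ⋃_u uK¹u⁻¹`».
[cite: Kottwitz1988, §2] [cite: Jacobowitz1962, §7 Thm. 7.1] [cite: Kottwitz1986, §3] -/
theorem exists_mem_unitaryGroupOfForm_span_eq_and_conj_mem_of_modular_antidiagTwo (hunr : Algebra.IsUnramifiedIn (𝓞 L) v.asIdeal)
    (g : GL (Fin 2) (w.1.adicCompletion L))
    (hg : ∃ J' ∈ glInt 2 (w.1.adicCompletion L),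
      (toPlace v w (HeckeCharacter.uniformizer ↥(maximalRealSubfield L) v : v.adicCompletion ↥(maximalRealSubfield L))) •
          (J' : Matrix (Fin 2) (Fin 2) (w.1.adicCompletion L)) =
        formCongr (galAdicCompletionMap (L := L) (IsCMField.complexConj L) hw) g
          (placeForm (Matrix.of fun i j : Fin 2 => if i.val + j.val + 1 = 2 then (1 : L) else 0) w.1)) :
    ∃ u ∈ unitaryGroupOfForm (galAdicCompletionMap (L := L) (IsCMField.complexConj L) hw)
        (placeForm (Matrix.of fun i j : Fin 2 => if i.val + j.val + 1 = 2 then (1 : L) else 0) w.1),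
      Submodule.span 𝒪[w.1.adicCompletion L] (Set.range ((g : Matrix (Fin 2) (Fin 2) (w.1.adicCompletion L)))ᵀ) =
        Submodule.span 𝒪[w.1.adicCompletion L] (Set.range
          (((u * glDiagonal 2 (w.1.adicCompletion L)
            ![1, Units.mk0 (toPlace v w (HeckeCharacter.uniformizer ↥(maximalRealSubfield L) v : v.adicCompletion ↥(maximalRealSubfield L)))
              (toPlace_uniformizer_ne_zero L v w hunr)] : GL (Fin 2) (w.1.adicCompletion L)) : Matrix (Fin 2) (Fin 2) (w.1.adicCompletion L)))ᵀ) ∧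
      ∀ γ : GL (Fin 2) (w.1.adicCompletion L),
        (Submodule.span 𝒪[w.1.adicCompletion L] (Set.range ((g : Matrix (Fin 2) (Fin 2) (w.1.adicCompletion L)))ᵀ)).map
            ((Matrix.toLin' (γ : Matrix (Fin 2) (Fin 2) (w.1.adicCompletion L))).restrictScalars 𝒪[w.1.adicCompletion L]) =
          Submodule.span 𝒪[w.1.adicCompletion L] (Set.range ((g : Matrix (Fin 2) (Fin 2) (w.1.adicCompletion L)))ᵀ) ↔
        u⁻¹ * γ * u ∈ (glInt 2 (w.1.adicCompletion L)).map (MulAut.conj (glDiagonal 2 (w.1.adicCompletion L)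
            ![1, Units.mk0 (toPlace v w (HeckeCharacter.uniformizer ↥(maximalRealSubfield L) v : v.adicCompletion ↥(maximalRealSubfield L)))
              (toPlace_uniformizer_ne_zero L v w hunr)])).toMonoidHom := by
  obtain ⟨u, hu, k, hk, rfl⟩ := exists_mem_unitaryGroupOfForm_mul_glDiagonal_mul_of_modular_antidiagTwo L v w hw hunr g hg
  set S := glDiagonal 2 (w.1.adicCompletion L)
    ![1, Units.mk0 (toPlace v w (HeckeCharacter.uniformizer ↥(maximalRealSubfield L) v : v.adicCompletion ↥(maximalRealSubfield L)))
      (toPlace_uniformizer_ne_zero L v w hunr)] with hS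
  have hΛ : Submodule.span 𝒪[w.1.adicCompletion L] (Set.range (((u * S * k : GL (Fin 2) (w.1.adicCompletion L)) :
        Matrix (Fin 2) (Fin 2) (w.1.adicCompletion L)))ᵀ) =
      Submodule.span 𝒪[w.1.adicCompletion L] (Set.range (((u * S : GL (Fin 2) (w.1.adicCompletion L)) :
        Matrix (Fin 2) (Fin 2) (w.1.adicCompletion L)))ᵀ) := by
    have hk' : (u * S * k)⁻¹ * (u * S) = k⁻¹ := by
      simp only [mul_inv_rev, mul_assoc, inv_mul_cancel_left, inv_mul_cancel, mul_one]
    rw [span_range_transpose_eq_iff, hk']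
    exact inv_mem hk
  refine ⟨u, hu, hΛ, fun γ => ?_⟩
  rw [hΛ, map_span_eq_self_iff_conj_mem, Literature.GroupTheory.mem_map_conj_iff]

include hw in
/-- **THE SECOND COLOUR AT `(Φ₂)_w`, group currency** (the `e = 1` half of the support-localisation corollary of I-5a's vertex frame): if
`ᵗσ_w(g)(Φ₂)_w g ∈ ϖ_w · GL₂(𝒪_w)` and `g⁻¹ γ g ∈ GL₂(𝒪_w)` then `∃ u ∈ U((Φ₂)_w)(L_w)`, `u⁻¹ γ u ∈ K′ := (GL₂(𝒪_w)).map (conj diag(1, ϖ_w))`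
(the `K′` token of ★ `IwahoriGLTwoVertexStabilizers`). [cite: Kottwitz1988, §2] [cite: Jacobowitz1962, §7 Thm. 7.1] -/
theorem exists_mem_unitaryGroupOfForm_conj_mem_map_conj_glDiagonal_of_modular_antidiagTwo (hunr : Algebra.IsUnramifiedIn (𝓞 L) v.asIdeal)
    (g γ : GL (Fin 2) (w.1.adicCompletion L))
    (hg : ∃ J' ∈ glInt 2 (w.1.adicCompletion L),
      (toPlace v w (HeckeCharacter.uniformizer ↥(maximalRealSubfield L) v : v.adicCompletion ↥(maximalRealSubfield L))) •
          (J' : Matrix (Fin 2) (Fin 2) (w.1.adicCompletion L)) =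
        formCongr (galAdicCompletionMap (L := L) (IsCMField.complexConj L) hw) g
          (placeForm (Matrix.of fun i j : Fin 2 => if i.val + j.val + 1 = 2 then (1 : L) else 0) w.1))
    (hγg : g⁻¹ * γ * g ∈ glInt 2 (w.1.adicCompletion L)) :
    ∃ u ∈ unitaryGroupOfForm (galAdicCompletionMap (L := L) (IsCMField.complexConj L) hw)
        (placeForm (Matrix.of fun i j : Fin 2 => if i.val + j.val + 1 = 2 then (1 : L) else 0) w.1),
      u⁻¹ * γ * u ∈ (glInt 2 (w.1.adicCompletion L)).map (MulAut.conj (glDiagonal 2 (w.1.adicCompletion L)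
        ![1, Units.mk0 (toPlace v w (HeckeCharacter.uniformizer ↥(maximalRealSubfield L) v : v.adicCompletion ↥(maximalRealSubfield L)))
          (toPlace_uniformizer_ne_zero L v w hunr)])).toMonoidHom := by
  obtain ⟨u, hu, k, hk, rfl⟩ := exists_mem_unitaryGroupOfForm_mul_glDiagonal_mul_of_modular_antidiagTwo L v w hw hunr g hg
  set S := glDiagonal 2 (w.1.adicCompletion L)
    ![1, Units.mk0 (toPlace v w (HeckeCharacter.uniformizer ↥(maximalRealSubfield L) v : v.adicCompletion ↥(maximalRealSubfield L)))
      (toPlace_uniformizer_ne_zero L v w hunr)] with hS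
  refine ⟨u, hu, (Literature.GroupTheory.mem_map_conj_iff _ _ _).2 ?_⟩
  have h : S⁻¹ * (u⁻¹ * γ * u) * S = k * ((u * S * k)⁻¹ * γ * (u * S * k)) * k⁻¹ := by
    simp only [mul_inv_rev, mul_assoc, mul_inv_cancel_left, mul_inv_cancel, mul_one]
  rw [h]
  exact mul_mem (mul_mem hk hγg) (inv_mem hk)

include hw in
/-- **On the carrier `↥U((Φ₂)_w)(L_w)`** (token `Literature.AlgebraicGeometry.ShimuraVarieties.unitaryGroup`, definitionally the same subgroup as
`unitaryGroupOfForm`): with `K¹ := ((GL₂(𝒪_w)).map (conj diag(1, ϖ_w))).subgroupOf U`, every `γ ∈ U` fixing a ϖ-modular lattice `g𝒪_w²` is `y k y⁻¹`,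
`y : ↥U`, `k ∈ K¹` — `γ ∈ ⋃_y y K¹ y⁻¹`, the `e = 1` half of «`{γ ∈ U | tr γ ∈ 𝒪_w} = ⋃_y yK⁰y⁻¹ ∪ ⋃_y yK¹y⁻¹`». [cite: Kottwitz1988, §2]
[cite: Jacobowitz1962, §7 Thm. 7.1] -/
theorem exists_eq_mul_mul_inv_of_modular_antidiagTwo (hunr : Algebra.IsUnramifiedIn (𝓞 L) v.asIdeal)
    (g : GL (Fin 2) (w.1.adicCompletion L))
    (hg : ∃ J' ∈ glInt 2 (w.1.adicCompletion L),
      (toPlace v w (HeckeCharacter.uniformizer ↥(maximalRealSubfield L) v : v.adicCompletion ↥(maximalRealSubfield L))) •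
          (J' : Matrix (Fin 2) (Fin 2) (w.1.adicCompletion L)) =
        formCongr (galAdicCompletionMap (L := L) (IsCMField.complexConj L) hw) g
          (placeForm (Matrix.of fun i j : Fin 2 => if i.val + j.val + 1 = 2 then (1 : L) else 0) w.1))
    (γ : ↥(Literature.AlgebraicGeometry.ShimuraVarieties.unitaryGroup (galAdicCompletionMap (L := L) (IsCMField.complexConj L) hw)
      (placeForm (Matrix.of fun i j : Fin 2 => if i.val + j.val + 1 = 2 then (1 : L) else 0) w.1)))
    (hγg : g⁻¹ * (γ : GL (Fin 2) (w.1.adicCompletion L)) * g ∈ glInt 2 (w.1.adicCompletion L)) :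
    ∃ y : ↥(Literature.AlgebraicGeometry.ShimuraVarieties.unitaryGroup (galAdicCompletionMap (L := L) (IsCMField.complexConj L) hw)
        (placeForm (Matrix.of fun i j : Fin 2 => if i.val + j.val + 1 = 2 then (1 : L) else 0) w.1)),
      ∃ k ∈ ((glInt 2 (w.1.adicCompletion L)).map (MulAut.conj (glDiagonal 2 (w.1.adicCompletion L)
          ![1, Units.mk0 (toPlace v w (HeckeCharacter.uniformizer ↥(maximalRealSubfield L) v : v.adicCompletion ↥(maximalRealSubfield L)))
            (toPlace_uniformizer_ne_zero L v w hunr)])).toMonoidHom).subgroupOf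
        (Literature.AlgebraicGeometry.ShimuraVarieties.unitaryGroup (galAdicCompletionMap (L := L) (IsCMField.complexConj L) hw)
          (placeForm (Matrix.of fun i j : Fin 2 => if i.val + j.val + 1 = 2 then (1 : L) else 0) w.1)),
      γ = y * k * y⁻¹ := by
  obtain ⟨u, hu, h⟩ := exists_mem_unitaryGroupOfForm_conj_mem_map_conj_glDiagonal_of_modular_antidiagTwo L v w hw hunr g γ hg hγg
  have hu' : u ∈ Literature.AlgebraicGeometry.ShimuraVarieties.unitaryGroup (galAdicCompletionMap (L := L) (IsCMField.complexConj L) hw)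
      (placeForm (Matrix.of fun i j : Fin 2 => if i.val + j.val + 1 = 2 then (1 : L) else 0) w.1) := hu
  refine ⟨⟨u, hu'⟩, ⟨u, hu'⟩⁻¹ * γ * ⟨u, hu'⟩, ?_, ?_⟩
  · rw [Subgroup.mem_subgroupOf]
    exact h
  · simp only [mul_assoc, mul_inv_cancel_left, mul_inv_cancel, mul_one]

end CM

end Literature.NumberTheory.Automorphic.UnitaryGroup
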